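import Mathlib.Algebra.Order.Ring.Nat
import Mathlib.Algebra.Order.BigOperators.Group.Finset
import Mathlib.Algebra.BigOperators.Ring.Finset
import Mathlib.Tactic.Ring
import Mathlib.Tactic.Linarith
import HarnessLib

/-!
# DDS 2021, proof of Thm. 3.2: closing the transcript budgets `poly(n, d, 20^{k−1}) ≤ s^{c·7^{k−1}}`

Theorem-only arithmetic file (cell `val-lit`, row X2-DDS21, lead-np RULING (151)(e) "(D4)(iv)
BUDGET CLOSING"; 0 definitions, 0 named facts; sibling of `DDS21SizeTower.lean`). Source:
[DuttaDwivediSaxena2022] full version, proof of Thm. 3.2: the DiDIL stage data have syntactic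
degree "`D_{j+1} := O(d D_j) ⟹ D_j = d^{O(j)}`" and size "`s_j ≤ (sd)^{O(j·7^j)}` … In particular,
`s_{k−1} ≤ s^{O(k·7^k)}`; here we used that `d ≤ s`" (p0033 L886–890), and the trace-back costs
"`S_0 = s^{O(k 7^k)}`" (p0036 L952–959). In the tree's rendering the F(x)-side transcript
(`AC/DDS21TranscriptResidues.lean`) exports EXPLICIT budgets `S, Δ` that are polynomials in
`n, d, 20^{k−1}` (the tree's DiDIL degree tower is `20^j · d`, `DDS21DiDILStep.lean`
`bdd_didilIter`), and the assembly (`AC/DDS21Thm32Assembly.lean`, `_of_pow_budget`) wants ONE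
stage budget `σ₀ ≤ s ^ (c₀ · 7^(k−1))` to feed `stagePow_le_pow` (`DDS21SizeTower.lean` §7).

This file is the currency converter, in the uniform shape `x ≤ s ^ a` ("budget `a`"):

* §1 atoms: `budget_const` (`c ≤ 2^b ⇒ c ≤ s^b` for `s ≥ 2`), `budget_twenty_pow`
  (`20^j ≤ s^(5 j)`), `budget_twenty_pow_mul` (`20^j · d ≤ s^(5j+1)`); the generic atoms and
  closure steps `n ≤ s ⇒ n ≤ s^1`, products, powers, equal-exponent sums, raising the exponent
  are Mathlib one-liners (`pow_one`, `pow_add` + `Nat.mul_le_mul`, `pow_mul` +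
  `Nat.pow_le_pow_left`, `Nat.pow_le_pow_right`) and already in the tree under other families
  (`FineGrained.Sparsifier.pw_atom/pw_mul/pw_add`, `MetaComplexity.….xb_pow/le_pow_of_le_pow`),
  so they are NOT restated here;
* §2 closure steps specific to this use: `budget_add'` (sums with different exponents),
  `budget_succ` (`x + 1`), `budget_const_mul` (`c · x`), `budget_sum_range` / `budget_sum_fin`
  (sums of `m ≤ s^b` terms), `budget_prod_fin`;
* §3 closing the exponent against `7^(k−1)`: `lin_le_mul_pow` (`a + b·j ≤ (a + b)·t^j` for
  `t ≥ 2`), ★ `budget_close` (`x ≤ s^(a + b·(k−1)) ⇒ x ≤ s^((a+b)·7^(k−1))`; exponents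
  `a + b·(k−1)` arise from `budget_twenty_pow` applied to the `20^{k−1}` of the degree tower),
  the two-parameter form `budget_close_mul` (`x ≤ s^(a·7^(k−1) + b·(k−1) + c) ⇒
  x ≤ s^((a+b+c)·7^(k−1))`) and `budget_stage_le_fact` (`s^(c₀·7^(k−1)) ≤ s^(c₀·k·7^k)`);
* §4 worked shapes: `budget_monomial` / ★ `budget_monomial_close`
  (`C · n^a · d^b · (20^(k−1))^c ≤ s^((e + a + b + 5c)·7^(k−1))` for `C ≤ 2^e`, `n, d ≤ s`).

Every bound is an explicit closed form (no asymptotic constants), so that instantiating the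
transcript's `S(n,d,20^{k−1})`, `Δ(n,d,20^{k−1})` is a chain of these lemmas ending in the
single hypothesis `σ₀ ≤ s^(c₀·7^(k−1))` of the assembly. Honest framing: pure arithmetic;
`DDS2021_thm_3_2` stays OPEN by name; VP ≠ VNP is NOT proved.
-/

namespace Literature.Computability.AlgebraicComplexity

namespace DDS2021

/-! ### §1 Atoms -/

/-- Absolute constants: `c ≤ 2^b ⇒ c ≤ s^b` for `s ≥ 2` (the `O(1)`'s of the printed recursions).
[cite: DuttaDwivediSaxena2022, §3 proof of Thm. 3.2 (full version p0033 L886–890)] -/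
theorem budget_const {s c b : ℕ} (hs : 2 ≤ s) (hc : c ≤ 2 ^ b) : c ≤ s ^ b :=
  hc.trans (Nat.pow_le_pow_left hs b)

/-- **The DiDIL degree-tower base**: `20^j ≤ s^(5·j)` for `s ≥ 2` (the tree's degree tower of
the DiDIL step is `20^j · d`, `DDS21DiDILStep.lean`; print: "`D_j = d^{O(j)}`").
[cite: DuttaDwivediSaxena2022, §3 proof of Thm. 3.2 (full version p0033 L888–889)] -/
theorem budget_twenty_pow {s : ℕ} (hs : 2 ≤ s) (j : ℕ) : 20 ^ j ≤ s ^ (5 * j) := by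
  calc 20 ^ j ≤ (2 ^ 5) ^ j := Nat.pow_le_pow_left (by norm_num) j
    _ ≤ (s ^ 5) ^ j := Nat.pow_le_pow_left (Nat.pow_le_pow_left hs 5) j
    _ = s ^ (5 * j) := by rw [← pow_mul]

/-- `20^j · d ≤ s^(5·j + 1)` for `d ≤ s`, `s ≥ 2` (the stage-`j` degree bound `B_j = 20^j · d`).
[cite: DuttaDwivediSaxena2022, §3 proof of Thm. 3.2 (full version p0033 L888–889)] -/
theorem budget_twenty_pow_mul {s d : ℕ} (hs : 2 ≤ s) (hd : d ≤ s) (j : ℕ) :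
    20 ^ j * d ≤ s ^ (5 * j + 1) := by
  rw [pow_add, pow_one]
  exact Nat.mul_le_mul (budget_twenty_pow hs j) hd

/-! ### §2 Closure of the budget currency `x ≤ s ^ a` -/

/-- Sums with different budgets: `x ≤ s^a`, `y ≤ s^b ⇒ x + y ≤ s^(a + b + 1)` (`s ≥ 2`).
[cite: DuttaDwivediSaxena2022, §3 proof of Thm. 3.2 (full version p0036 L957–959)] -/
theorem budget_add' {s x y a b : ℕ} (hs : 2 ≤ s) (hx : x ≤ s ^ a) (hy : y ≤ s ^ b) :
    x + y ≤ s ^ (a + b + 1) := by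
  have hs1 : 1 ≤ s := le_trans (by norm_num) hs
  have hx' : x ≤ s ^ (a + b) := hx.trans (Nat.pow_le_pow_right hs1 (Nat.le_add_right a b))
  have hy' : y ≤ s ^ (a + b) := hy.trans (Nat.pow_le_pow_right hs1 (Nat.le_add_left b a))
  calc x + y ≤ s ^ (a + b) + s ^ (a + b) := Nat.add_le_add hx' hy'
    _ = s ^ (a + b) * 2 := by ring
    _ ≤ s ^ (a + b) * s := Nat.mul_le_mul_left _ hs
    _ = s ^ (a + b + 1) := by rw [pow_succ]

/-- Successors: `x ≤ s^a ⇒ x + 1 ≤ s^(a+1)` (`s ≥ 2`).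
[cite: DuttaDwivediSaxena2022, §3 proof of Thm. 3.2 (full version p0036 L957–959)] -/
theorem budget_succ {s x a : ℕ} (hs : 2 ≤ s) (hx : x ≤ s ^ a) : x + 1 ≤ s ^ (a + 1) := by
  have h1 : 1 ≤ s ^ a := Nat.one_le_pow _ _ (le_trans (by norm_num) hs)
  calc x + 1 ≤ s ^ a + s ^ a := Nat.add_le_add hx h1
    _ = s ^ a * 2 := by ring
    _ ≤ s ^ a * s := Nat.mul_le_mul_left _ hs
    _ = s ^ (a + 1) := by rw [pow_succ]

/-- Constant multiples: `c ≤ 2^b`, `x ≤ s^a ⇒ c · x ≤ s^(b + a)` (`s ≥ 2`).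
[cite: DuttaDwivediSaxena2022, §3 proof of Thm. 3.2 (full version p0033 L886–890)] -/
theorem budget_const_mul {s c x a b : ℕ} (hs : 2 ≤ s) (hc : c ≤ 2 ^ b) (hx : x ≤ s ^ a) :
    c * x ≤ s ^ (b + a) := by
  rw [pow_add]
  exact Nat.mul_le_mul (budget_const hs hc) hx

/-- Sums over `range m` of terms of budget `a`, with `m ≤ s^b` terms: budget `b + a`.
[cite: DuttaDwivediSaxena2022, §3 proof of Thm. 3.2 (full version p0036 L957–959)] -/
theorem budget_sum_range {s m a b : ℕ} (x : ℕ → ℕ) (hm : m ≤ s ^ b)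
    (hx : ∀ i < m, x i ≤ s ^ a) : (∑ i ∈ Finset.range m, x i) ≤ s ^ (b + a) := by
  calc (∑ i ∈ Finset.range m, x i) ≤ ∑ _i ∈ Finset.range m, s ^ a :=
        Finset.sum_le_sum fun i hi => hx i (Finset.mem_range.mp hi)
    _ = m * s ^ a := by rw [Finset.sum_const_nat (fun _ _ => rfl), Finset.card_range]
    _ ≤ s ^ b * s ^ a := Nat.mul_le_mul_right _ hm
    _ = s ^ (b + a) := by rw [pow_add]

/-- Sums over `Fin m` of terms of budget `a`, with `m ≤ s^b` terms: budget `b + a`.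
[cite: DuttaDwivediSaxena2022, §3 proof of Thm. 3.2 (full version p0036 L957–959)] -/
theorem budget_sum_fin {s m a b : ℕ} (x : Fin m → ℕ) (hm : m ≤ s ^ b)
    (hx : ∀ i, x i ≤ s ^ a) : (∑ i, x i) ≤ s ^ (b + a) := by
  calc (∑ i, x i) ≤ ∑ _i : Fin m, s ^ a := Finset.sum_le_sum fun i _ => hx i
    _ = m * s ^ a := by
        rw [Finset.sum_const_nat (fun _ _ => rfl), Finset.card_univ, Fintype.card_fin]
    _ ≤ s ^ b * s ^ a := Nat.mul_le_mul_right _ hm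
    _ = s ^ (b + a) := by rw [pow_add]

/-- Products over `Fin m` of factors of budget `a`: budget `a · m`.
[cite: DuttaDwivediSaxena2022, §3 proof of Thm. 3.2 (full version p0033 L886–890)] -/
theorem budget_prod_fin {s m a : ℕ} (x : Fin m → ℕ) (hx : ∀ i, x i ≤ s ^ a) :
    (∏ i, x i) ≤ s ^ (a * m) := by
  calc (∏ i, x i) ≤ ∏ _i : Fin m, s ^ a := Finset.prod_le_prod' fun i _ => hx i
    _ = (s ^ a) ^ m := by rw [Finset.prod_const, Finset.card_univ, Fintype.card_fin]
    _ = s ^ (a * m) := by rw [← pow_mul]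

/-! ### §3 Closing the exponent against `7^(k−1)` -/

/-- Linear-in-`j` exponents are absorbed by a geometric tower: `a + b·j ≤ (a + b)·t^j` for
`t ≥ 2` (since `1 ≤ t^j` and `j ≤ t^j`).
[cite: DuttaDwivediSaxena2022, §3 proof of Thm. 3.2, "`s_j ≤ (sd)^{O(j·7^j)}`" (full version p0033 L888–890)] -/
theorem lin_le_mul_pow {a b t : ℕ} (ht : 2 ≤ t) (j : ℕ) : a + b * j ≤ (a + b) * t ^ j := by
  have h1 : 1 ≤ t ^ j := Nat.one_le_pow _ _ (le_trans (by norm_num) ht)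
  have h2 : j ≤ t ^ j := le_of_lt (Nat.lt_pow_self ht)
  calc a + b * j ≤ a * t ^ j + b * t ^ j :=
        Nat.add_le_add (Nat.le_mul_of_pos_right _ h1) (Nat.mul_le_mul_left _ h2)
    _ = (a + b) * t ^ j := by ring

/-- ★ **Closing a budget against `7^(k−1)`**: a budget linear in the number `k − 1` of DiDIL
rounds, `x ≤ s^(a + b·(k−1))` (as produced by `budget_twenty_pow` from the `20^{k−1}` of the
degree tower), is within `s^((a + b) · 7^(k−1))` — the stage-budget shape `σ₀ ≤ s^(c₀·7^(k−1))`
consumed by `stagePow_le_pow`.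
[cite: DuttaDwivediSaxena2022, §3 proof of Thm. 3.2, "`s_{k−1} ≤ s^{O(k·7^k)}`" (full version p0033 L888–890; p0036 L957–959)] -/
theorem budget_close {s x a b k : ℕ} (hs : 1 ≤ s) (hx : x ≤ s ^ (a + b * (k - 1))) :
    x ≤ s ^ ((a + b) * 7 ^ (k - 1)) :=
  hx.trans (Nat.pow_le_pow_right hs (lin_le_mul_pow (by norm_num) (k - 1)))

/-- Two-parameter closing: `x ≤ s^(a·7^(k−1) + b·(k−1) + c) ⇒ x ≤ s^((a + b + c)·7^(k−1))`
(budgets that already carry a `7^(k−1)` part, e.g. after composing with a stage size).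
[cite: DuttaDwivediSaxena2022, §3 proof of Thm. 3.2 (full version p0033 L888–890; p0036 L957–959)] -/
theorem budget_close_mul {s x a b c k : ℕ} (hs : 1 ≤ s)
    (hx : x ≤ s ^ (a * 7 ^ (k - 1) + b * (k - 1) + c)) :
    x ≤ s ^ ((a + b + c) * 7 ^ (k - 1)) := by
  refine hx.trans (Nat.pow_le_pow_right hs ?_)
  have h := lin_le_mul_pow (a := c) (b := b) (t := 7) (by norm_num) (k - 1)
  nlinarith [h]

/-- The stage budget in the fact's final currency: `x ≤ s^(c₀ · 7^(k−1))` and `1 ≤ k` give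
`x ≤ s^(c₀ · k · 7^k)` (for consumers that skip `stagePow_le_pow`).
[cite: DuttaDwivediSaxena2022, Thm. 3.2 "size `s^{O(k·7^k)}`" (full version p0026 L713–715)] -/
theorem budget_stage_le_fact {s x c₀ k : ℕ} (hs : 1 ≤ s) (hk : 1 ≤ k)
    (hx : x ≤ s ^ (c₀ * 7 ^ (k - 1))) : x ≤ s ^ (c₀ * k * 7 ^ k) := by
  refine hx.trans (Nat.pow_le_pow_right hs ?_)
  have h7 : 7 ^ (k - 1) ≤ 7 ^ k := Nat.pow_le_pow_right (by norm_num) (Nat.sub_le k 1)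
  calc c₀ * 7 ^ (k - 1) ≤ c₀ * 7 ^ k := Nat.mul_le_mul_left _ h7
    _ ≤ c₀ * 7 ^ k * k := Nat.le_mul_of_pos_right _ hk
    _ = c₀ * k * 7 ^ k := by ring

/-! ### §4 Worked shapes (the monomials a transcript budget is made of) -/

/-- A monomial `C · n^a · d^b · (20^(k−1))^c` with `C ≤ 2^e`, `n, d ≤ s`, `s ≥ 2` has budget
`e + a + b + 5·c·(k−1)`. [cite: DuttaDwivediSaxena2022, §3 proof of Thm. 3.2 (full version p0033 L886–890)] -/
theorem budget_monomial {s n d C a b c e k : ℕ} (hs : 2 ≤ s) (hn : n ≤ s) (hd : d ≤ s)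
    (hC : C ≤ 2 ^ e) :
    C * n ^ a * d ^ b * (20 ^ (k - 1)) ^ c ≤ s ^ (e + a + b + 5 * c * (k - 1)) := by
  have h20 : (20 ^ (k - 1)) ^ c ≤ s ^ (5 * c * (k - 1)) := by
    calc (20 ^ (k - 1)) ^ c ≤ (s ^ (5 * (k - 1))) ^ c :=
          Nat.pow_le_pow_left (budget_twenty_pow hs (k - 1)) c
      _ = s ^ (5 * c * (k - 1)) := by rw [← pow_mul]; ring_nf
  rw [pow_add, pow_add, pow_add]
  exact Nat.mul_le_mul (Nat.mul_le_mul (Nat.mul_le_mul (budget_const hs hC)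
    (Nat.pow_le_pow_left hn a)) (Nat.pow_le_pow_left hd b)) h20

/-- ★ The same monomial CLOSED against `7^(k−1)`: budget `(e + a + b + 5c) · 7^(k−1)`.
[cite: DuttaDwivediSaxena2022, §3 proof of Thm. 3.2 (full version p0033 L888–890)] -/
theorem budget_monomial_close {s n d C a b c e k : ℕ} (hs : 2 ≤ s) (hn : n ≤ s) (hd : d ≤ s)
    (hC : C ≤ 2 ^ e) :
    C * n ^ a * d ^ b * (20 ^ (k - 1)) ^ c ≤ s ^ ((e + a + b + 5 * c) * 7 ^ (k - 1)) := by
  exact budget_close (a := e + a + b) (b := 5 * c) (le_trans (by norm_num) hs)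
    (budget_monomial (a := a) (b := b) (c := c) (k := k) hs hn hd hC)

end DDS2021

end Literature.Computability.AlgebraicComplexity
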